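import Mathlib
import Literature.NumberTheory.Transcendental.KZCalculus

/-!
# `VolumeFormOffPlane` (stmt-KontsevichZagierPeriods-14935) — line `Sketch`,
stub `stub_periodSplit` (two-period splitting of the `ℤ`-weighted family property)

Pure algebra behind the line's v7 "two periods" layer for the Kontsevich–Zagier calculus
(`Literature/NumberTheory/Transcendental/KZCalculus.lean`). In dimension `N` we are given two
classes `GB`, `GS` of integral representations and two real numbers `ω₁`, `ω₂` such that

* `ω₁`, `ω₂` are linearly independent over the real algebraic numbers;
* every member of `GB` has value `a · ω₁` and every member of `GS` has value `b · ω₂` with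
  `a`, `b` real algebraic;
* each class separately has the `ℤ`-WEIGHTED FAMILY PROPERTY: a `ℤ`-weighted combination of
  members (members wherever the weight is non-zero) of total weighted value `0` is a relation.

Then the two classes have the JOINT `ℤ`-weighted family property: if
`Σ cB·value ρB + Σ cS·value ρS = 0` (with `ρB i ∈ GB` wherever `cB i ≠ 0`, `ρS ν ∈ GS` wherever
`cS ν ≠ 0`), then `Σ cB•[ρB] + Σ cS•[ρS] ∈ relations`.

Proof: `psp_exists_algebraic_sum` writes `Σ cB·value ρB = A·ω₁` and `Σ cS·value ρS = B·ω₂`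
with `A`, `B` real algebraic (`ℤ`-combinations of algebraic numbers, through integrality over the
field `ℚ`); linear independence gives `A = B = 0`, so both weighted values vanish separately, the
two separate family properties apply, and `relations` is closed under addition.

Sources: Kontsevich–Zagier 2001, §1.2 (the calculus); the rest is bookkeeping.
-/

noncomputable section

open MeasureTheory Set
open Literature.NumberTheory.Transcendental

namespace Summit.KontsevichZagierPeriods.SymplecticScissors.LogPolytope

/-- **One-period collapse of a weighted value.** If every member of a class `G` of integral
representations has value `a · ω` with `a` real algebraic, then any `ℤ`-weighted sum of values of
a family lying in `G` wherever its weight is non-zero equals `A · ω` for some real algebraic `A`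
(namely `A = Σ cᵢ aᵢ`, with `aᵢ := 0` where `cᵢ = 0`). [folklore] -/
theorem psp_exists_algebraic_sum {N k : ℕ} {G : KZ.IntegralRep N → Prop} {ω : ℝ}
    (hval : ∀ ρ, G ρ → ∃ a : ℝ, IsAlgebraic ℚ a ∧ ρ.value = a * ω)
    (ρ : Fin k → KZ.IntegralRep N) (c : Fin k → ℤ) (hG : ∀ i, c i ≠ 0 → G (ρ i)) :
    ∃ A : ℝ, IsAlgebraic ℚ A ∧ ∑ i, (c i : ℝ) * (ρ i).value = A * ω := by
  have hi : ∀ i, ∃ a : ℝ, IsAlgebraic ℚ a ∧ (c i : ℝ) * (ρ i).value = (c i : ℝ) * a * ω := by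
    intro i
    by_cases h : c i = 0
    · exact ⟨0, isAlgebraic_zero, by simp [h]⟩
    · obtain ⟨a, ha, hv⟩ := hval _ (hG i h)
      exact ⟨a, ha, by rw [hv, mul_assoc]⟩
  choose a ha hv using hi
  refine ⟨∑ i, (c i : ℝ) * a i, ?_, ?_⟩
  · exact isAlgebraic_iff_isIntegral.mpr (IsIntegral.sum _ fun i _ =>
      (isAlgebraic_iff_isIntegral.mp (isAlgebraic_int (c i))).mul
        (isAlgebraic_iff_isIntegral.mp (ha i)))
  · rw [Finset.sum_mul]
    exact Finset.sum_congr rfl fun i _ => hv i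

/-- **Two-period splitting.** Let `GB`, `GS` be two classes of integral representations in
dimension `N` whose values are real-algebraic multiples of `ω₁`, resp. `ω₂`, where `ω₁`, `ω₂` are
linearly independent over the real algebraic numbers, and suppose each class separately has the
`ℤ`-weighted family property (a `ℤ`-weighted combination of members of total weighted value `0` is
a KZ-relation). Then so does their union: a mixed `ℤ`-weighted combination
`Σ cB•[ρB] + Σ cS•[ρS]` of total weighted value `0` is a KZ-relation — the total value reads
`A·ω₁ + B·ω₂ = 0` with `A`, `B` algebraic, hence `A = B = 0` and the two halves are relations
separately. [folklore] -/
theorem stub_periodSplit : ∀ (N : ℕ) (GB GS : KZ.IntegralRep N → Prop) (ω₁ ω₂ : ℝ),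
    (∀ a b : ℝ, IsAlgebraic ℚ a → IsAlgebraic ℚ b → a * ω₁ + b * ω₂ = 0 → a = 0 ∧ b = 0) →
    (∀ ρ, GB ρ → ∃ a : ℝ, IsAlgebraic ℚ a ∧ ρ.value = a * ω₁) →
    (∀ ρ, GS ρ → ∃ b : ℝ, IsAlgebraic ℚ b ∧ ρ.value = b * ω₂) →
    (∀ (k : ℕ) (σ : Fin k → KZ.IntegralRep N) (w : Fin k → ℤ), (∀ j, w j ≠ 0 → GB (σ j)) →
      ∑ j, (w j : ℝ) * (σ j).value = 0 → ∑ j, w j • KZ.of (σ j) ∈ KZ.relations) →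
    (∀ (k : ℕ) (σ : Fin k → KZ.IntegralRep N) (w : Fin k → ℤ), (∀ j, w j ≠ 0 → GS (σ j)) →
      ∑ j, (w j : ℝ) * (σ j).value = 0 → ∑ j, w j • KZ.of (σ j) ∈ KZ.relations) →
    ∀ (k m : ℕ) (ρB : Fin k → KZ.IntegralRep N) (ρS : Fin m → KZ.IntegralRep N)
      (cB : Fin k → ℤ) (cS : Fin m → ℤ),
      (∀ i, cB i ≠ 0 → GB (ρB i)) → (∀ ν, cS ν ≠ 0 → GS (ρS ν)) →
      ∑ i, (cB i : ℝ) * (ρB i).value + ∑ ν, (cS ν : ℝ) * (ρS ν).value = 0 →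
      ∑ i, cB i • KZ.of (ρB i) + ∑ ν, cS ν • KZ.of (ρS ν) ∈ KZ.relations := by
  intro N GB GS ω₁ ω₂ hind hGBval hGSval hGBw hGSw k m ρB ρS cB cS hGB hGS hsum
  obtain ⟨A, hA, hAsum⟩ := psp_exists_algebraic_sum hGBval ρB cB hGB
  obtain ⟨B, hB, hBsum⟩ := psp_exists_algebraic_sum hGSval ρS cS hGS
  rw [hAsum, hBsum] at hsum
  obtain ⟨hA0, hB0⟩ := hind A B hA hB hsum
  refine KZ.relations.add_mem (hGBw k ρB cB hGB ?_) (hGSw m ρS cS hGS ?_)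
  · rw [hAsum, hA0, zero_mul]
  · rw [hBsum, hB0, zero_mul]

end Summit.KontsevichZagierPeriods.SymplecticScissors.LogPolytope

end
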